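import Summits.ValiantsHypothesis.ValiantsHypothesis.Theorems.DepthWindowHomComponents
import Mathlib.Data.Matrix.Mul
import Mathlib.Algebra.BigOperators.Intervals
import Mathlib.Algebra.BigOperators.Fin
import HarnessLib

/-!
# Route `DepthWindow`, g8 — truncated components of a product as an iterated matrix product

First kernel piece of the `(2,3)` SLIVER LEMMA programme (lens-4 NODE-v7 §6 step (1), NODE-v8 §4):
for ℕ-valued weights `w` and a truncation order `d`, the weight-`≤ d` components of a polynomial
`p` assemble into the upper-triangular TOEPLITZ matrix `toeplitz w d p ∈ M_{d+1}(R[X])`,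
`(i, j) ↦ [p]_{j-i}` (`0` below the diagonal), and

* `toeplitz_mul` — `toeplitz (p * q) = toeplitz p * toeplitz q` (the Cauchy product of
  components, `weightedHomogeneousComponent_mul` of `Theorems/DepthWindowHomComponents.lean`,
  is matrix multiplication of Toeplitz matrices), `toeplitz_one`, hence a monoid hom
  `toeplitzHom` and `toeplitz_list_prod`;
* `weightedHomogeneousComponent_list_prod_eq_imm` — **`[∏ₗ Vₗ]_e = (∏ₗ toeplitz w d Vₗ) 0 e`**:
  the weight-`e` component (`e ≤ d`) of a product gate of fan-in `t` is the `(0, e)` entry of an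
  ITERATED MATRIX PRODUCT of width `d + 1` and length `t` whose matrix entries are the components
  `[Vₗ]_ε`, `ε ≤ d`, of the factors — i.e. `E_e(y)|_{y_{l,ε} ↦ [Vₗ]_ε}` of NODE-v7 §6 is computed
  by a layered algebraic branching program of width `d + 1`.

This is the entry point for the meet-in-the-middle depth reduction of `IMM_{d+1, t}` (the next
piece), which is what lets the product layer of a level be merged with the one below at cost
`t^{O(√d)}` instead of `t^{d}`.  Pure `MvPolynomial`/`Matrix` algebra over a commutative
semiring; nothing here bears on `VP ≠ VNP`.

[cite: LimayeSrinivasanTavenas2025, Lemma 11] [cite: Strassen1973, §3]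
-/

set_option linter.dupNamespace false

namespace Summit.ValiantsHypothesis.ValiantsHypothesis.Theorems.DepthWindow

open MvPolynomial Finset

variable {σ R : Type*} [CommSemiring R]

/-- The truncated Toeplitz matrix of weighted components: `(i, j) ↦ [p]_{j - i}` for `i ≤ j`,
`0` below the diagonal. [cite: Strassen1973, §3] -/
noncomputable def toeplitz (w : σ → ℕ) (d : ℕ) (p : MvPolynomial σ R) :
    Matrix (Fin (d + 1)) (Fin (d + 1)) (MvPolynomial σ R) :=
  Matrix.of fun i j =>
    if (i : ℕ) ≤ j then weightedHomogeneousComponent w ((j : ℕ) - i) p else 0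

/-- Entries of the Toeplitz matrix. -/
theorem toeplitz_apply (w : σ → ℕ) (d : ℕ) (p : MvPolynomial σ R) (i j : Fin (d + 1)) :
    toeplitz w d p i j =
      if (i : ℕ) ≤ j then weightedHomogeneousComponent w ((j : ℕ) - i) p else 0 := rfl

/-- The first row of the Toeplitz matrix lists the components `[p]_0, …, [p]_d`. -/
theorem toeplitz_zero_apply (w : σ → ℕ) (d : ℕ) (p : MvPolynomial σ R) (j : Fin (d + 1)) :
    toeplitz w d p 0 j = weightedHomogeneousComponent w j p := by
  simp [toeplitz_apply]

/-- `toeplitz 1 = 1`. -/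
theorem toeplitz_one (w : σ → ℕ) (d : ℕ) : toeplitz w d (1 : MvPolynomial σ R) = 1 := by
  classical
  refine Matrix.ext fun i j => ?_
  rw [toeplitz_apply, Matrix.one_apply,
    weightedHomogeneousComponent_of_mem
      ((mem_weightedHomogeneousSubmodule R w 0 1).mpr (isWeightedHomogeneous_one R w))]
  by_cases hij : (i : ℕ) ≤ j
  · rw [if_pos hij]
    by_cases h : i = j
    · rw [if_pos h, if_pos (by rw [h]; omega)]
    · rw [if_neg h, if_neg]
      intro h0
      exact h (Fin.ext (by omega))
  · rw [if_neg hij, if_neg]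
    rintro rfl
    exact hij le_rfl

/-- A range sum supported on an interval `[i, j]`, `j < n`, is the interval sum. -/
theorem sum_range_ite_interval {β : Type*} [AddCommMonoid β] (n i j : ℕ) (hj : j < n)
    (g : ℕ → β) :
    ∑ k ∈ range n, (if i ≤ k ∧ k ≤ j then g k else 0) = ∑ k ∈ Ico i (j + 1), g k := by
  rw [← Finset.sum_filter]
  congr 1
  ext k
  simp only [Finset.mem_filter, Finset.mem_range, Finset.mem_Ico]
  omega

/-- **Cauchy product = matrix product.**  `toeplitz (p * q) = toeplitz p * toeplitz q`.
[cite: Strassen1973, §3] -/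
theorem toeplitz_mul (w : σ → ℕ) (d : ℕ) (p q : MvPolynomial σ R) :
    toeplitz w d (p * q) = toeplitz w d p * toeplitz w d q := by
  classical
  refine Matrix.ext fun i j => ?_
  rw [Matrix.mul_apply, toeplitz_apply]
  simp_rw [toeplitz_apply]
  have hsummand : ∀ k : Fin (d + 1),
      (if (i : ℕ) ≤ k then weightedHomogeneousComponent w ((k : ℕ) - i) p else 0) *
        (if (k : ℕ) ≤ j then weightedHomogeneousComponent w ((j : ℕ) - k) q else 0) =
      if (i : ℕ) ≤ k ∧ (k : ℕ) ≤ j then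
        weightedHomogeneousComponent w ((k : ℕ) - i) p *
          weightedHomogeneousComponent w ((j : ℕ) - k) q else 0 := by
    intro k
    by_cases h1 : (i : ℕ) ≤ k <;> by_cases h2 : (k : ℕ) ≤ j <;> simp [h1, h2]
  simp_rw [hsummand]
  rw [Fin.sum_univ_eq_sum_range (fun k => if (i : ℕ) ≤ k ∧ k ≤ (j : ℕ) then
      weightedHomogeneousComponent w (k - i) p * weightedHomogeneousComponent w ((j : ℕ) - k) q
    else 0) (d + 1),
    sum_range_ite_interval (d + 1) i j j.isLt]
  by_cases hij : (i : ℕ) ≤ j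
  · rw [if_pos hij, weightedHomogeneousComponent_mul,
      Finset.Nat.sum_antidiagonal_eq_sum_range_succ_mk, Finset.sum_Ico_eq_sum_range,
      show (j : ℕ) + 1 - i = ((j : ℕ) - i).succ by omega]
    refine Finset.sum_congr rfl fun k hk => ?_
    rw [Finset.mem_range] at hk
    rw [Nat.add_sub_cancel_left, show (j : ℕ) - (i + k) = (j : ℕ) - i - k by omega]
  · rw [if_neg hij]
    symm
    refine Finset.sum_eq_zero fun k hk => ?_
    rw [Finset.mem_Ico] at hk
    omega

/-- The Toeplitz map as a monoid homomorphism `R[X] →* M_{d+1}(R[X])`. -/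
noncomputable def toeplitzHom (w : σ → ℕ) (d : ℕ) :
    MvPolynomial σ R →* Matrix (Fin (d + 1)) (Fin (d + 1)) (MvPolynomial σ R) where
  toFun := toeplitz w d
  map_one' := toeplitz_one w d
  map_mul' := toeplitz_mul w d

/-- `toeplitzHom` is `toeplitz`. -/
theorem toeplitzHom_apply (w : σ → ℕ) (d : ℕ) (p : MvPolynomial σ R) :
    toeplitzHom w d p = toeplitz w d p := rfl

/-- Toeplitz matrix of a list product. -/
theorem toeplitz_list_prod (w : σ → ℕ) (d : ℕ) (L : List (MvPolynomial σ R)) :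
    toeplitz w d L.prod = (L.map (toeplitz w d)).prod := by
  rw [← toeplitzHom_apply, map_list_prod]
  rfl

/-- Toeplitz matrix of a `Fin`-indexed product. -/
theorem toeplitz_prod_univ (w : σ → ℕ) (d : ℕ) {t : ℕ} (v : Fin t → MvPolynomial σ R) :
    toeplitz w d (∏ l, v l) = (List.ofFn fun l => toeplitz w d (v l)).prod := by
  rw [← List.prod_ofFn, toeplitz_list_prod, List.map_ofFn]
  rfl

/-- **The weight-`e` component of a product gate is an iterated matrix product of width `d + 1`.**
For `e ≤ d`, `[∏ₗ Vₗ]_e = (∏ₗ toeplitz w d Vₗ) 0 e`, the matrices having entries `[Vₗ]_ε`, `ε ≤ d`.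
[cite: LimayeSrinivasanTavenas2025, Lemma 11] -/
theorem weightedHomogeneousComponent_list_prod_eq_imm (w : σ → ℕ) (d : ℕ)
    (L : List (MvPolynomial σ R)) (e : Fin (d + 1)) :
    weightedHomogeneousComponent w e L.prod = (L.map (toeplitz w d)).prod 0 e := by
  rw [← toeplitz_list_prod, toeplitz_zero_apply]

/-- `Fin`-indexed form of `weightedHomogeneousComponent_list_prod_eq_imm`. -/
theorem weightedHomogeneousComponent_prod_eq_imm (w : σ → ℕ) (d : ℕ) {t : ℕ}
    (v : Fin t → MvPolynomial σ R) (e : Fin (d + 1)) :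
    weightedHomogeneousComponent w e (∏ l, v l) =
      (List.ofFn fun l => toeplitz w d (v l)).prod 0 e := by
  rw [← toeplitz_prod_univ, toeplitz_zero_apply]

end Summit.ValiantsHypothesis.ValiantsHypothesis.Theorems.DepthWindow
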